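import Literature.Probability.Percolation.TriLowestCrossingSwitch
import Literature.Probability.Percolation.HalfPlaneTwoArmPoint
import HarnessLib

/-!
# The U-shaped half-annulus of the half-plane is a lattice quad

Topic `Literature/Probability/Percolation`; family `crit-perc`, statement **crit-perc.S16**
(`Literature.Probability.Percolation.triTheta_exponent`). The arm events *near a boundary* of
Kesten's near-critical theory live in half-annuli of the upper half-plane (P. Nolin,
*Near-critical percolation in two dimensions*, EJP 13 (2008), §4.6: "the event `B_{j,σ}(n, N)`
that there exist `j` arms that stay in the upper half-plane"; W. Werner, PCMI 2009, first exercise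
sheet: arms in the half-hexagon `x + H_n`; §4.4 of Nolin's proof of the separation theorem works in
"U-shaped regions" `U^{i,ext}_N`). This file provides the parallelogram version of such a region
as an abstract lattice quad (`TriQuad`, `TriLowestCrossingSwitch.lean`), so that the Hex
dichotomy, the crossing lemma, the lowest-crossing stopping set and **colour switching** become
available for arms in the half-plane:

* `uQuad k N` (`1 ≤ k`, `k + 1 ≤ N`): the sites `U = Q_N ∖ I_k°` of the half-box
  `Q_N = [-N, N] × [0, N]` outside the open inner half-box `I_k° = [-k+1, k-1] × [0, k-1]`, with
  the four boundary parts `L` = the sites of `U` adjacent to `I_k°` (inner boundary),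
  `R` = `{x₀ = ±N} ∪ {x₁ = N}` (outer boundary), `B = [-N, -k] × {0}` and `T = [k, N] × {0}` (the
  two segments of the real line). Its axioms are proved by **padding**: in the parallelogram
  `[-N-1, N+1] × [-1, N+1]` one colours the inner half-box, the row below it and the outer frame
  with the colour of the inner–outer crossings, and the rest of the row `x₁ = -1` with the colour
  of the `B–T` crossings; then `tri_hex` (`uQuad_hex`) and `PathIn.tri_crossings_meet`
  (`uQuad_meet`) in the parallelogram translate into the Hex dichotomy and the crossing lemma of
  the U-shaped region, and the reference `T–B` path runs along the inner boundary (`uQuad_refTB`).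
* Consequences (from the abstract theory): the explored set of the innermost open crossing is a
  stopping set, and **colour switching** (`real_uTwoOpen_le`): at `p = 1/2`, two disjoint open
  crossings of the U-shaped region from the inner to the outer boundary are no more likely than an
  open and a closed one — the input reducing the monochromatic case `κ = (T, T)` of the half-plane
  two-arm estimate `Nolin2008_halfPlane_twoArm` to the bichromatic one (Aizenman–Duplantier–Aharony
  colour switching; Nolin 2008, §4.6 with Thm. 24 (i): "For any `σ ∈ 𝔖₂`").

## References

* P. Nolin, Near-critical percolation in two dimensions, *Electron. J. Probab.* 13 (2008), §4.4
  (U-shaped regions), §4.6 (arms in the half-plane) [Nolin2008].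
* W. Werner, *Lectures on two-dimensional critical percolation*, IAS/Park City Math. Ser. 16
  (2009), first exercise sheet ("Color switching", 4): other simply connected subsets; "Two-arm
  exponent in the half-plane") [WernerPCMI2009].
* H. Kesten, *Percolation theory for mathematicians*, Birkhäuser (1982), §2.2–2.3 [KestenPTM1982].

## Mathlib / tree

Tree: `TriQuad` and its theory (`TriLowestCrossingSwitch.lean`), `tri_hex` (`TriHexLemma.lean`),
`PathIn.tri_crossings_meet`, `triGraph_adj_cases` (`TriCrossingsMeet.lean`), `PathIn.exit`,
`PathIn.last_exit` (`SitePaths.lean`), `pathIn_shift`, `triStripFinset` (`TriRSWChaining.lean`),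
`triGraph_adj_coord` (`TriHexLemma.lean`), `pathIn_row`, `pathIn_col`, `site_eq_vec`, `triGraph_adj_up`,
`triGraph_adj_right` (`HalfPlaneTwoArmPoint.lean`).
-/

noncomputable section

open MeasureTheory Set

namespace Literature.Probability.Percolation

open LatticeModels

/-! ### The U-shaped half-annulus -/

/-- The open **inner half-box** `I_k° = [-k+1, k-1] × [0, k-1]`. [cite: Nolin2008, §4.6 (B_{j,σ}(n, N): arms from ∂S'_n)] -/
def uInner (k : ℕ) : Set (Site 2) := {z | -(k : ℤ) + 1 ≤ z 0 ∧ z 0 ≤ k - 1 ∧ 0 ≤ z 1 ∧ z 1 ≤ k - 1}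

/-- Membership in `uInner`, unfolded. [folklore] -/
@[simp] theorem mem_uInner {k : ℕ} {z : Site 2} :
    z ∈ uInner k ↔ -(k : ℤ) + 1 ≤ z 0 ∧ z 0 ≤ k - 1 ∧ 0 ≤ z 1 ∧ z 1 ≤ k - 1 := Iff.rfl

open Classical in
/-- The sites of the **U-shaped half-annulus** `U_{k,N} = Q_N ∖ I_k°`, `Q_N = [-N, N] × [0, N]`. [cite: Nolin2008, §4.4 (U-shaped regions) and §4.6] -/
def uSites (k N : ℕ) : Finset (Site 2) :=
  (triStripFinset (-(N : ℤ)) 0 (2 * N) N).filter fun z => z ∉ uInner k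

/-- Membership in `uSites`, in coordinates. [folklore] -/
theorem mem_uSites {k N : ℕ} {z : Site 2} :
    z ∈ uSites k N ↔ (-(N : ℤ) ≤ z 0 ∧ z 0 ≤ N ∧ 0 ≤ z 1 ∧ z 1 ≤ N) ∧ z ∉ uInner k := by
  classical
  rw [uSites, Finset.mem_filter, ← Finset.mem_coe, coe_triStripFinset, mem_triStrip]
  push_cast
  constructor
  · rintro ⟨h, h'⟩; exact ⟨by omega, h'⟩
  · rintro ⟨h, h'⟩; exact ⟨by omega, h'⟩

/-- Membership in `↑(uSites k N)`, in coordinates. [folklore] -/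
theorem mem_coe_uSites {k N : ℕ} {z : Site 2} :
    z ∈ (↑(uSites k N) : Set (Site 2)) ↔ (-(N : ℤ) ≤ z 0 ∧ z 0 ≤ N ∧ 0 ≤ z 1 ∧ z 1 ≤ N) ∧ z ∉ uInner k := by
  rw [Finset.mem_coe, mem_uSites]

/-- The **inner boundary**: the sites of `U_{k,N}` adjacent to the inner half-box (the arc
`∂S'_k` of Nolin's `B_{j,σ}(k, N)`, for the parallelogram, without its two upper corners). [cite: Nolin2008, §4.6] -/
def uL (k N : ℕ) : Set (Site 2) := {z | z ∈ (↑(uSites k N) : Set (Site 2)) ∧ ∃ w ∈ uInner k, triGraph.Adj w z}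

/-- The **outer boundary** `{x₀ = ±N} ∪ {x₁ = N}` of `U_{k,N}`. [cite: Nolin2008, §4.6] -/
def uR (k N : ℕ) : Set (Site 2) :=
  {z | z ∈ (↑(uSites k N) : Set (Site 2)) ∧ (z 0 = -(N : ℤ) ∨ z 0 = N ∨ z 1 = N)}

/-- The **left segment of the real line** `B = [-N, -k] × {0}`. [cite: Nolin2008, §4.6] -/
def uB (k N : ℕ) : Set (Site 2) := {z | z 1 = 0 ∧ -(N : ℤ) ≤ z 0 ∧ z 0 ≤ -(k : ℤ)}

/-- The **right segment of the real line** `T = [k, N] × {0}`. [cite: Nolin2008, §4.6] -/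
def uT (k N : ℕ) : Set (Site 2) := {z | z 1 = 0 ∧ (k : ℤ) ≤ z 0 ∧ z 0 ≤ N}

variable {k N : ℕ}

/-- The left segment lies in the U-shaped region. [folklore] -/
theorem uB_subset (hk : 1 ≤ k) : uB k N ⊆ ↑(uSites k N) := by
  rintro z ⟨h1, h2, h3⟩
  rw [mem_coe_uSites, mem_uInner]
  exact ⟨⟨h2, by omega, by omega, by omega⟩, by omega⟩

/-- The right segment lies in the U-shaped region. [folklore] -/
theorem uT_subset (hk : 1 ≤ k) : uT k N ⊆ ↑(uSites k N) := by
  rintro z ⟨h1, h2, h3⟩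
  rw [mem_coe_uSites, mem_uInner]
  exact ⟨⟨by omega, h3, by omega, by omega⟩, by omega⟩


/-- `𝕋`-neighbours of a site of the row `x₁ = -1`: in the row `x₁ = 0` they are `(s, 0)` and
`(s - 1, 0)`. [folklore] -/
theorem adj_of_row_neg_one {s : ℤ} {a b : Site 2} (ha1 : a 1 = -1) (ha0 : a 0 = s) (h : triGraph.Adj a b) :
    (b 1 = 0 ∧ (b 0 = s ∨ b 0 = s - 1)) ∨ (b 1 = -1 ∧ (b 0 = s + 1 ∨ b 0 = s - 1)) ∨ b 1 = -2 := by
  have := triGraph_adj_cases h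
  omega

/-! ### The padded parallelogram -/

section Padding

variable (k N : ℕ)

/-- The row below the half-box, outside the inner half-box: coloured like the `B–T` crossings. [folklore] -/
def uRowOut : Set (Site 2) :=
  {z | z 1 = -1 ∧ -(N : ℤ) - 1 ≤ z 0 ∧ z 0 ≤ N + 1 ∧ (z 0 ≤ -(k : ℤ) ∨ (k : ℤ) ≤ z 0)}

/-- The row below the inner half-box: coloured like the inner–outer crossings. [folklore] -/
def uRowIn : Set (Site 2) := {z | z 1 = -1 ∧ -(k : ℤ) + 1 ≤ z 0 ∧ z 0 ≤ k - 1}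

/-- The outer frame `{x₀ = ±(N+1), 0 ≤ x₁} ∪ {x₁ = N+1}`: coloured like the inner–outer crossings. [folklore] -/
def uFrame : Set (Site 2) :=
  {z | ((z 0 = -(N : ℤ) - 1 ∨ z 0 = N + 1) ∧ 0 ≤ z 1 ∧ z 1 ≤ N + 1) ∨ (z 1 = N + 1 ∧ -(N : ℤ) - 1 ≤ z 0 ∧ z 0 ≤ N + 1)}

/-- The padded parallelogram `[-N-1, N+1] × [-1, N+1]`. [folklore] -/
def uBig : Set (Site 2) := {z | -(N : ℤ) - 1 ≤ z 0 ∧ z 0 ≤ N + 1 ∧ -1 ≤ z 1 ∧ z 1 ≤ N + 1}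

/-- The translation taking the padded parallelogram to `rectangle (2N+2) (N+2)`. [folklore] -/
def uShift : Site 2 := ![-(N : ℤ) - 1, -1]

variable {k N}

/-- Membership in `uRowOut`, unfolded. [folklore] -/
@[simp] theorem mem_uRowOut {z : Site 2} : z ∈ uRowOut k N ↔
    z 1 = -1 ∧ -(N : ℤ) - 1 ≤ z 0 ∧ z 0 ≤ N + 1 ∧ (z 0 ≤ -(k : ℤ) ∨ (k : ℤ) ≤ z 0) := Iff.rfl
/-- Membership in `uRowIn`, unfolded. [folklore] -/
@[simp] theorem mem_uRowIn {z : Site 2} : z ∈ uRowIn k ↔ z 1 = -1 ∧ -(k : ℤ) + 1 ≤ z 0 ∧ z 0 ≤ k - 1 := Iff.rfl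
/-- Membership in `uFrame`, unfolded. [folklore] -/
@[simp] theorem mem_uFrame {z : Site 2} : z ∈ uFrame N ↔
    ((z 0 = -(N : ℤ) - 1 ∨ z 0 = N + 1) ∧ 0 ≤ z 1 ∧ z 1 ≤ N + 1) ∨ (z 1 = N + 1 ∧ -(N : ℤ) - 1 ≤ z 0 ∧ z 0 ≤ N + 1) :=
  Iff.rfl
/-- Membership in `uBig`, unfolded. [folklore] -/
@[simp] theorem mem_uBig {z : Site 2} : z ∈ uBig N ↔ -(N : ℤ) - 1 ≤ z 0 ∧ z 0 ≤ N + 1 ∧ -1 ≤ z 1 ∧ z 1 ≤ N + 1 :=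
  Iff.rfl

/-- The translated rectangle is the padded parallelogram. [folklore] -/
theorem mem_rectangle_iff_uBig {z : Site 2} :
    z ∈ (↑(rectangle (2 * N + 2) (N + 2)) : Set (Site 2)) ↔ z + uShift N ∈ uBig N := by
  rw [Finset.mem_coe, mem_rectangle_iff, mem_uBig]
  simp only [uShift, Pi.add_apply, Matrix.cons_val_zero, Matrix.cons_val_one, Matrix.cons_val_fin_one]
  push_cast; omega

/-- Transport of a path of the translated rectangle to the padded parallelogram. [folklore] -/
theorem pathIn_uBig_of_rectangle {D : Set (Site 2)} {p q : Site 2}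
    (h : PathIn triGraph (↑(rectangle (2 * N + 2) (N + 2)) ∩ {z | z + uShift N ∈ D}) p q) :
    PathIn triGraph (uBig N ∩ D) (p + uShift N) (q + uShift N) :=
  pathIn_shift (uShift N) (fun z hz => show z + uShift N ∈ uBig N ∩ D from ⟨mem_rectangle_iff_uBig.1 hz.1, hz.2⟩) h

end Padding

/-! ### The Hex dichotomy of the U-shaped region -/

/-- **Hex dichotomy in the U-shaped half-annulus.** For every colouring `C`, either a `𝕋`-path of
`U_{k,N} ∩ C` joins the inner boundary to the outer boundary, or a `𝕋`-path of `U_{k,N} ∩ Cᶜ`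
joins the left segment `[-N, -k] × {0}` to the right segment `[k, N] × {0}` of the real line
(`1 ≤ k`, `k + 1 ≤ N`). Proof: `tri_hex` in the padded parallelogram `[-N-1, N+1] × [-1, N+1]`
for the colouring "`U ∩ Cᶜ`, and the row `x₁ = -1` outside `(-k, k)`"; a left–right crossing of
it passes through `U ∩ Cᶜ` from a site above the left part of the row (in the left segment) to
one above the right part (in the right segment), and a top–bottom crossing of the complementary
colouring ("`U ∩ C`, the inner half-box, the row below it and the outer frame") leaves the inner
part through a site adjacent to the inner half-box and reaches the frame at a site of the outer
boundary. [cite: Nolin2008, §4.4 and §4.6 (crossings of U-shaped regions; arms in the half-plane)] [cite: KestenPTM1982, §2.2–2.3] -/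
theorem uQuad_hex (hk : 1 ≤ k) (hkN : k + 1 ≤ N) (C : Set (Site 2)) :
    (∃ x ∈ uL k N, ∃ y ∈ uR k N, PathIn triGraph (↑(uSites k N) ∩ C) x y) ∨
      (∃ x ∈ uB k N, ∃ y ∈ uT k N, PathIn triGraph (↑(uSites k N) ∩ Cᶜ) x y) := by
  set U : Set (Site 2) := ↑(uSites k N) with hU
  set C' : Set (Site 2) := (U ∩ Cᶜ) ∪ uRowOut k N with hC'
  have hk' : (1 : ℤ) ≤ k := by exact_mod_cast hk
  have hkN' : (k : ℤ) + 1 ≤ N := by exact_mod_cast hkN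
  have memU : ∀ {z : Site 2}, z ∈ U ↔ (-(N : ℤ) ≤ z 0 ∧ z 0 ≤ N ∧ 0 ≤ z 1 ∧ z 1 ≤ N) ∧
      ¬ (-(k : ℤ) + 1 ≤ z 0 ∧ z 0 ≤ k - 1 ∧ 0 ≤ z 1 ∧ z 1 ≤ k - 1) := fun {z} => by
    rw [hU, mem_coe_uSites, mem_uInner]
  rcases tri_hex (2 * N + 2) (N + 2) {z | z + uShift N ∈ C'} with ⟨p, hp, q, hq, hpq⟩ | ⟨p, hp, q, hq, hpq⟩
  · -- a left–right crossing of `C'`: a `B–T` path of `U ∩ Cᶜ`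
    right
    have hP := pathIn_uBig_of_rectangle hpq
    simp only [leftSide, rightSide, Finset.mem_filter] at hp hq
    have hp0 : (p + uShift N) 0 = -(N : ℤ) - 1 := by simp [uShift, hp.2]
    have hq0 : (q + uShift N) 0 = (N : ℤ) + 1 := by simp [uShift, hq.2]; ring
    set PL : Set (Site 2) := {z | z ∈ uRowOut k N ∧ z 0 ≤ -(k : ℤ)} with hPL
    have hstart : p + uShift N ∈ PL := by
      rcases hP.left_mem.2 with h | h
      · have := (memU.1 h.1).1; omega
      · exact ⟨h, by have := h.2.2.2; omega⟩
    have hend : q + uShift N ∉ PL := fun h => by have := h.2; omega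
    obtain ⟨a, b, haPL, -, hbPL, hab, hbq⟩ := hP.last_exit hstart hend
    have hbC' : b ∈ C' := hbq.left_mem.1.2
    have ha1 : a 1 = -1 := haPL.1.1
    -- `b` is a `Cᶜ`-site of the left segment
    have hb : b ∈ U ∩ Cᶜ ∧ b ∈ uB k N := by
      rcases adj_of_row_neg_one ha1 rfl hab with ⟨hb1, hb0⟩ | ⟨hb1, hb0⟩ | hb1
      · rcases hbC' with h | h
        · have hbU := (memU.1 h.1).1
          exact ⟨h, hb1, hbU.1, by have := haPL.2; omega⟩
        · exfalso; have := h.1; omega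
      · exfalso
        rcases hbC' with h | h
        · have := (memU.1 h.1).1; omega
        · exact hbPL ⟨h, by have := haPL.2; have := h.2.2.2; omega⟩
      · exfalso
        rcases hbC' with h | h
        · have := (memU.1 h.1).1; omega
        · have := h.1; omega
    obtain ⟨hbU, hbB⟩ := hb
    -- first entry into the right part `PR`
    set PR : Set (Site 2) := {z | z ∈ uRowOut k N ∧ (k : ℤ) ≤ z 0} with hPR
    have hbR : b ∈ {z | z ∉ PR} := fun h => by have := h.1.1; have := hbB.1; omega
    have hqR : q + uShift N ∉ {z : Site 2 | z ∉ PR} := by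
      intro h; apply h
      rcases hP.right_mem.2 with h' | h'
      · have := (memU.1 h'.1).1; omega
      · exact ⟨h', by omega⟩
    obtain ⟨a', b', ha'R, hb'R, hb'A, ha'b', hpath⟩ := hbq.exit hbR hqR
    have hb'PR : b' ∈ PR := not_not.1 hb'R
    have hmid : ∀ z ∈ {z : Site 2 | z ∉ PR} ∩ ((uBig N ∩ C') \ PL), z ∈ U ∩ Cᶜ := by
      rintro z ⟨hzR, ⟨-, hzB | hzP⟩, hzL⟩
      · exact hzB
      · exfalso
        rcases hzP.2.2.2 with h0 | h0
        · exact hzL ⟨hzP, h0⟩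
        · exact hzR ⟨hzP, h0⟩
    have hseg := hpath.mono hmid
    have ha'U : a' ∈ U ∩ Cᶜ := hmid a' ⟨ha'R, hpath.right_mem.2⟩
    -- `a'` is a `Cᶜ`-site of the right segment
    have hb'1 : b' 1 = -1 := hb'PR.1.1
    have ha' : a' ∈ uT k N := by
      have hco := memU.1 ha'U.1
      rcases adj_of_row_neg_one hb'1 rfl ha'b'.symm with ⟨h1, h0⟩ | ⟨h1, -⟩ | h1
      · refine ⟨h1, ?_, hco.1.2.1⟩
        have : (k : ℤ) - 1 ≤ a' 0 := by have := hb'PR.2; omega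
        rcases eq_or_lt_of_le this with h2 | h2
        · exfalso; exact hco.2 ⟨by omega, by omega, by omega, by omega⟩
        · omega
      · exfalso; have := hco.1; omega
      · exfalso; have := hco.1; omega
    exact ⟨b, hbB, a', ha', hseg⟩
  · -- a top–bottom crossing of the complement: an inner–outer path of `U ∩ C`
    left
    have hP := pathIn_uBig_of_rectangle (D := C'ᶜ) (hpq.mono fun z hz => ⟨hz.1, hz.2⟩)
    simp only [bottomSide, topSide, Finset.mem_filter] at hp hq
    have hp1 : (p + uShift N) 1 = -1 := by simp [uShift, hp.2]
    have hq1 : (q + uShift N) 1 = (N : ℤ) + 1 := by simp [uShift, hq.2]; ring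
    -- the start is below the inner half-box
    set p' := p + uShift N with hp'
    set q' := q + uShift N with hq'
    have hp'B : p' ∈ uBig N := hP.left_mem.1
    rw [mem_uBig] at hp'B
    have hp'In : p' ∈ uRowIn k := by
      have hnot : p' ∉ C' := hP.left_mem.2
      refine ⟨hp1, ?_, ?_⟩ <;> by_contra hcon <;> apply hnot <;> right
      · exact ⟨hp1, hp'B.1, hp'B.2.1, Or.inl (by omega)⟩
      · exact ⟨hp1, hp'B.1, hp'B.2.1, Or.inr (by omega)⟩
    set Inner : Set (Site 2) := uInner k ∪ uRowIn k with hInner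
    have hpI : p' ∈ Inner := Or.inr hp'In
    have hqI : q' ∉ Inner := by
      rintro (h | h)
      · rw [mem_uInner] at h; omega
      · have := h.1; omega
    obtain ⟨a, b, haI, -, hbI, hab, hbq⟩ := hP.last_exit hpI hqI
    have hbA : b ∈ uBig N ∩ C'ᶜ := hbq.left_mem.1
    have hb0 := triGraph_adj_coord hab 0
    have hb1 := triGraph_adj_coord hab 1
    -- sites of the remaining path are `C`-sites of `U`
    have hgood : ∀ z : Site 2, z ∈ uBig N ∩ C'ᶜ → z ∉ Inner → z ∉ uFrame N → z ∈ U ∩ C := by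
      rintro z ⟨hzB, hzC'⟩ hzI hzF
      rw [mem_uBig] at hzB
      have hz1 : 0 ≤ z 1 := by
        by_contra hneg
        have hz1' : z 1 = -1 := by omega
        by_cases hout : z 0 ≤ -(k : ℤ) ∨ (k : ℤ) ≤ z 0
        · exact hzC' (Or.inr ⟨hz1', hzB.1, hzB.2.1, hout⟩)
        · exact hzI (Or.inr ⟨hz1', by omega, by omega⟩)
      have hzQ : -(N : ℤ) ≤ z 0 ∧ z 0 ≤ N ∧ 0 ≤ z 1 ∧ z 1 ≤ N := by
        rw [mem_uFrame] at hzF; omega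
      have hzU : z ∈ U := memU.2 ⟨hzQ, fun h => hzI (Or.inl h)⟩
      exact ⟨hzU, not_not.1 fun hzC => hzC' (Or.inl ⟨hzU, hzC⟩)⟩
    -- `b` is a `C`-site of the inner boundary
    have haco : -(k : ℤ) + 1 ≤ a 0 ∧ a 0 ≤ k - 1 ∧ -1 ≤ a 1 ∧ a 1 ≤ k - 1 := by
      rcases haI with h | h
      · rw [mem_uInner] at h; omega
      · have := h.1; have := h.2; omega
    have hbF : b ∉ uFrame N := by rw [mem_uFrame]; omega
    have hbU : b ∈ U ∩ C := hgood b hbA hbI hbF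
    have hbL : b ∈ uL k N := by
      refine ⟨hbU.1, ?_⟩
      rcases haI with haIn | haRow
      · exact ⟨a, haIn, hab⟩
      · -- from the row below the inner half-box one enters `U` only at the corner `(-k, 0)`
        have hbco := memU.1 hbU.1
        rcases adj_of_row_neg_one haRow.1 rfl hab with ⟨h1, h0⟩ | ⟨h1, -⟩ | h1
        · have hb0' : b 0 = -(k : ℤ) := by
            rcases h0 with h0 | h0 <;> by_contra hne <;> exact hbco.2 ⟨by omega, by omega, by omega, by omega⟩
          refine ⟨![-(k : ℤ) + 1, 0], by rw [mem_uInner]; simp; omega, ?_⟩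
          rw [site_eq_vec b, hb0', h1]
          have := triGraph_adj_right (-(k : ℤ)) 0
          exact this.symm
        · exfalso; omega
        · exfalso; omega
    -- first arrival at the frame
    have hbR : b ∈ {z : Site 2 | z ∉ uFrame N} := hbF
    have hqR : q' ∉ {z : Site 2 | z ∉ uFrame N} := by
      intro h; apply h
      have hqB : q' ∈ uBig N := hP.right_mem.1
      rw [mem_uBig] at hqB
      exact Or.inr ⟨hq1, hqB.1, hqB.2.1⟩
    obtain ⟨a'', b'', ha''R, hb''R, hb''A, hab'', hpath⟩ := hbq.exit hbR hqR
    have hb''F : b'' ∈ uFrame N := not_not.1 hb''R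
    have hseg : PathIn triGraph (U ∩ C) b a'' :=
      hpath.mono fun z hz => hgood z hz.2.1 hz.2.2 hz.1
    have ha''U := memU.1 (hseg.right_mem).1
    have h0'' := triGraph_adj_coord hab'' 0
    have h1'' := triGraph_adj_coord hab'' 1
    have ha''R' : a'' ∈ uR k N := by
      refine ⟨hseg.right_mem.1, ?_⟩
      rw [mem_uFrame] at hb''F
      omega
    exact ⟨b, hbL, a'', ha''R', hseg⟩


/-! ### The crossing lemma of the U-shaped region -/

/-- **An inner–outer path and a path between the two segments of the real line meet** in the
U-shaped half-annulus (`1 ≤ k`, `k + 1 ≤ N`): if `A, A' ⊆ U_{k,N}`, some `𝕋`-path of `A` joins the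
inner boundary to the outer boundary and some `𝕋`-path of `A'` joins `[-N, -k] × {0}` to
`[k, N] × {0}`, then `A ∩ A' ≠ ∅`. Proof: pad `A` by the inner half-box, the column below the
starting neighbour and the outer frame into a top–bottom crossing of `[-N-1, N+1] × [-1, N+1]`,
and `A'` by the two outer parts of the row `x₁ = -1` into a left–right crossing; the paddings are
disjoint from each other and from `U`, so the common site given by `PathIn.tri_crossings_meet`
lies in `A ∩ A'`. [cite: KestenPTM1982, §2.2 (paths crossing a rectangle must intersect)] [cite: Nolin2008, §4.4 (U-shaped regions)] -/
theorem uQuad_meet (hk : 1 ≤ k) (hkN : k + 1 ≤ N) ⦃A A' : Set (Site 2)⦄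
    (hA : A ⊆ ↑(uSites k N)) (hA' : A' ⊆ ↑(uSites k N)) ⦃x y c d : Site 2⦄
    (hx : x ∈ uL k N) (hy : y ∈ uR k N) (hp : PathIn triGraph A x y)
    (hc : c ∈ uB k N) (hd : d ∈ uT k N) (hq : PathIn triGraph A' c d) : ∃ z, z ∈ A ∧ z ∈ A' := by
  have hk' : (1 : ℤ) ≤ k := by exact_mod_cast hk
  have hkN' : (k : ℤ) + 1 ≤ N := by exact_mod_cast hkN
  have memU : ∀ {z : Site 2}, z ∈ (↑(uSites k N) : Set (Site 2)) ↔ (-(N : ℤ) ≤ z 0 ∧ z 0 ≤ N ∧ 0 ≤ z 1 ∧ z 1 ≤ N) ∧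
      ¬ (-(k : ℤ) + 1 ≤ z 0 ∧ z 0 ≤ k - 1 ∧ 0 ≤ z 1 ∧ z 1 ≤ k - 1) := fun {z} => by
    rw [mem_coe_uSites, mem_uInner]
  -- the padded sets
  set A₁ : Set (Site 2) := A ∪ (uInner k ∪ (uRowIn k ∪ uFrame N)) with hA₁
  set A₁' : Set (Site 2) := A' ∪ uRowOut k N with hA₁'
  have hA₁b : ∀ z ∈ A₁, -(N : ℤ) - 1 ≤ z 0 ∧ z 0 ≤ N + 1 ∧ -1 ≤ z 1 ∧ z 1 ≤ N + 1 := by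
    rintro z (hz | hz | hz | hz)
    · have := (memU.1 (hA hz)).1; omega
    · rw [mem_uInner] at hz; omega
    · rw [mem_uRowIn] at hz; omega
    · rw [mem_uFrame] at hz; omega
  have hA₁'b : ∀ z ∈ A₁', -(N : ℤ) - 1 ≤ z 0 ∧ z 0 ≤ N + 1 ∧ -1 ≤ z 1 ∧ z 1 ≤ N + 1 := by
    rintro z (hz | hz)
    · have := (memU.1 (hA' hz)).1; omega
    · rw [mem_uRowOut] at hz; omega
  -- the top–bottom crossing in `A₁`: below the inner half-box, up to `x`, along the path, to the frame
  obtain ⟨hxU, w, hw, hwx⟩ := hx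
  rw [mem_uInner] at hw
  have hw1 : 0 ≤ w 1 := hw.2.2.1
  have t1 : PathIn triGraph A₁ ![w 0, -1] ![w 0, -1 + ((w 1 + 1).toNat : ℕ)] := by
    refine pathIn_col (w 0) (-1) _ fun j hj => ?_
    rcases Nat.eq_zero_or_pos j with rfl | hj0
    · exact Or.inr (Or.inr (Or.inl ⟨by simp, by simp; omega, by simp; omega⟩))
    · refine Or.inr (Or.inl ?_)
      rw [mem_uInner]; simp only [Matrix.cons_val_zero, Matrix.cons_val_one, Matrix.cons_val_fin_one]
      have := Int.toNat_of_nonneg (show 0 ≤ w 1 + 1 by omega); omega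
  have ew : (![w 0, -1 + ((w 1 + 1).toNat : ℕ)] : Site 2) = w := by
    rw [Int.toNat_of_nonneg (by omega), site_eq_vec w]; simp
  rw [ew] at t1
  have t2 : PathIn triGraph A₁ ![w 0, -1] y := (t1.tail hwx (Or.inl hp.left_mem)).trans (hp.mono subset_union_left)
  obtain ⟨hyU, hy'⟩ := hy
  have hyco := (memU.1 hyU).1
  have t3 : ∃ e : Site 2, e 1 = (N : ℤ) + 1 ∧ PathIn triGraph A₁ ![w 0, -1] e := by
    rcases hy' with h0 | h0 | h1
    · -- left column of the frame
      have hT0 : 0 ≤ (N : ℤ) + 1 - y 1 := by omega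
      have q3 : PathIn triGraph A₁ ![w 0, -1] ![-(N : ℤ) - 1, y 1] := by
        refine t2.tail ?_ (Or.inr (Or.inr (Or.inr (Or.inl ⟨Or.inl rfl, by simp; omega, by simp; omega⟩))))
        rw [site_eq_vec y, h0]
        have := triGraph_adj_right (-(N : ℤ) - 1) (y 1)
        rw [show -(N : ℤ) - 1 + 1 = -(N : ℤ) by ring] at this
        exact this.symm
      refine ⟨![-(N : ℤ) - 1, y 1 + (((N : ℤ) + 1 - y 1).toNat : ℕ)], by simp [Int.toNat_of_nonneg hT0], ?_⟩
      exact q3.trans (pathIn_col (-(N : ℤ) - 1) (y 1) _ fun j hj =>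
        Or.inr (Or.inr (Or.inr (Or.inl ⟨Or.inl rfl, by simp; omega, by
          simp only [Matrix.cons_val_one, Matrix.cons_val_fin_one]
          have := Int.toNat_of_nonneg hT0; omega⟩))))
    · -- right column of the frame
      have hT0 : 0 ≤ (N : ℤ) + 1 - y 1 := by omega
      have q3 : PathIn triGraph A₁ ![(N : ℤ) + 1, y 1] ![(N : ℤ) + 1, y 1] → PathIn triGraph A₁ ![w 0, -1] ![(N : ℤ) + 1, y 1] :=
        fun _ => by
          refine t2.tail ?_ (Or.inr (Or.inr (Or.inr (Or.inl ⟨Or.inr rfl, by simp; omega, by simp; omega⟩))))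
          rw [site_eq_vec y, h0]
          exact triGraph_adj_right (N : ℤ) (y 1)
      refine ⟨![(N : ℤ) + 1, y 1 + (((N : ℤ) + 1 - y 1).toNat : ℕ)], by simp [Int.toNat_of_nonneg hT0], ?_⟩
      exact (q3 (PathIn.refl (Or.inr (Or.inr (Or.inr (Or.inl ⟨Or.inr rfl, by simp; omega, by simp; omega⟩)))))).trans
        (pathIn_col ((N : ℤ) + 1) (y 1) _ fun j hj =>
          Or.inr (Or.inr (Or.inr (Or.inl ⟨Or.inr rfl, by simp; omega, by
            simp only [Matrix.cons_val_one, Matrix.cons_val_fin_one]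
            have := Int.toNat_of_nonneg hT0; omega⟩))))
    · -- top row of the frame: one step up
      refine ⟨![y 0, (N : ℤ) + 1], rfl, t2.tail ?_ (Or.inr (Or.inr (Or.inr (Or.inr ⟨rfl, by simp; omega, by simp; omega⟩))))⟩
      rw [site_eq_vec y, h1]
      exact triGraph_adj_up (y 0) N
  obtain ⟨e, he, hTB⟩ := t3
  -- the left–right crossing in `A₁'`: along the row below, through the `B–T` path
  obtain ⟨hc1, hc0, hc0'⟩ := hc
  obtain ⟨hd1, hd0, hd0'⟩ := hd
  have hKc : 0 ≤ c 0 + N + 1 := by omega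
  have l1 : PathIn triGraph A₁' ![-(N : ℤ) - 1, -1] ![-(N : ℤ) - 1 + ((c 0 + N + 1).toNat : ℕ), -1] :=
    pathIn_row (-(N : ℤ) - 1) (-1) _ fun j hj => Or.inr ⟨rfl, by simp, by
      simp only [Matrix.cons_val_zero]; have := Int.toNat_of_nonneg hKc; omega, Or.inl (by
      simp only [Matrix.cons_val_zero]; have := Int.toNat_of_nonneg hKc; omega)⟩
  have e1 : (![-(N : ℤ) - 1 + ((c 0 + N + 1).toNat : ℕ), -1] : Site 2) = ![c 0, -1] := by
    rw [Int.toNat_of_nonneg hKc]; congr 1; ring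
  rw [e1] at l1
  have l2 : PathIn triGraph A₁' ![-(N : ℤ) - 1, -1] c := by
    refine l1.tail ?_ (Or.inl hq.left_mem)
    rw [site_eq_vec c, hc1]
    exact triGraph_adj_up (c 0) (-1)
  have l3 : PathIn triGraph A₁' ![-(N : ℤ) - 1, -1] ![d 0, -1] := by
    refine (l2.trans (hq.mono subset_union_left)).tail ?_ (Or.inr ⟨rfl, by simp; omega, by simp; omega, Or.inr (by
      simp only [Matrix.cons_val_zero]; exact hd0)⟩)
    rw [site_eq_vec d, hd1]
    have := triGraph_adj_up (d 0) (-1); simp at this; exact this.symm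
  have hKd : 0 ≤ (N : ℤ) + 1 - d 0 := by omega
  have l4 : PathIn triGraph A₁' ![d 0, -1] ![d 0 + (((N : ℤ) + 1 - d 0).toNat : ℕ), -1] :=
    pathIn_row (d 0) (-1) _ fun j hj => Or.inr ⟨rfl, by simp; omega, by
      simp only [Matrix.cons_val_zero]; have := Int.toNat_of_nonneg hKd; omega, Or.inr (by
      simp only [Matrix.cons_val_zero]; omega)⟩
  have e4 : (![d 0 + (((N : ℤ) + 1 - d 0).toNat : ℕ), -1] : Site 2) = ![(N : ℤ) + 1, -1] := by
    rw [Int.toNat_of_nonneg hKd]; congr 1; ring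
  rw [e4] at l4
  have hLR := l3.trans l4
  -- the two crossings meet, at a site which is not a padding site
  obtain ⟨z, hz', hz⟩ := PathIn.tri_crossings_meet (L := -(N : ℤ) - 1) (R := (N : ℤ) + 1) (B := -1)
    (T := (N : ℤ) + 1) hA₁'b hA₁b hLR (by simp) (by simp) hTB (by simp) he
  rcases hz' with hz' | hz'
  · rcases hz with hz | hz | hz | hz
    · exact ⟨z, hz, hz'⟩
    · exfalso; exact (memU.1 (hA' hz')).2 (by rw [mem_uInner] at hz; exact hz)
    · exfalso; have := (memU.1 (hA' hz')).1; rw [mem_uRowIn] at hz; omega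
    · exfalso; have := (memU.1 (hA' hz')).1; rw [mem_uFrame] at hz; omega
  · exfalso
    rw [mem_uRowOut] at hz'
    rcases hz with hz | hz | hz | hz
    · have := (memU.1 (hA hz)).1; omega
    · rw [mem_uInner] at hz; omega
    · rw [mem_uRowIn] at hz; omega
    · rw [mem_uFrame] at hz; omega

/-- **A reference path between the two segments of the real line**: `(k, 0) ↗ (k, k) ← (-k, k) ↘
(-k, 0)` along the inner boundary, inside `U_{k,N}`. [folklore] -/
theorem uQuad_refTB (hk : 1 ≤ k) (hkN : k + 1 ≤ N) :
    ∃ t ∈ uT k N, ∃ b ∈ uB k N, PathIn triGraph (↑(uSites k N) : Set (Site 2)) t b := by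
  have hk' : (1 : ℤ) ≤ k := by exact_mod_cast hk
  have hkN' : (k : ℤ) + 1 ≤ N := by exact_mod_cast hkN
  refine ⟨![(k : ℤ), 0], ⟨by simp, by simp, by simp; omega⟩, ![-(k : ℤ), 0], ⟨by simp, by simp; omega, by simp⟩, ?_⟩
  have s1 : PathIn triGraph (↑(uSites k N) : Set (Site 2)) ![(k : ℤ), 0] ![(k : ℤ), 0 + (k : ℕ)] :=
    pathIn_col (k : ℤ) 0 k fun j hj => by
      rw [mem_coe_uSites, mem_uInner]; simp; omega
  have s2 : PathIn triGraph (↑(uSites k N) : Set (Site 2)) ![-(k : ℤ), (k : ℤ)] ![-(k : ℤ) + ((2 * k : ℕ) : ℤ), (k : ℤ)] :=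
    pathIn_row (-(k : ℤ)) (k : ℤ) (2 * k) fun j hj => by
      rw [mem_coe_uSites, mem_uInner]; simp; omega
  have s3 : PathIn triGraph (↑(uSites k N) : Set (Site 2)) ![-(k : ℤ), 0] ![-(k : ℤ), 0 + (k : ℕ)] :=
    pathIn_col (-(k : ℤ)) 0 k fun j hj => by
      rw [mem_coe_uSites, mem_uInner]; simp; omega
  have e1 : (![(k : ℤ), 0 + (k : ℕ)] : Site 2) = ![(k : ℤ), (k : ℤ)] := by simp
  have e2 : (![-(k : ℤ) + ((2 * k : ℕ) : ℤ), (k : ℤ)] : Site 2) = ![(k : ℤ), (k : ℤ)] := by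
    congr 1; push_cast; ring
  have e3 : (![-(k : ℤ), 0 + (k : ℕ)] : Site 2) = ![-(k : ℤ), (k : ℤ)] := by simp
  rw [e1] at s1; rw [e2] at s2; rw [e3] at s3
  exact (s1.trans s2.symm).trans s3.symm

/-! ### The lattice quad and colour switching -/

/-- **The U-shaped half-annulus is a lattice quad** (`1 ≤ k`, `k + 1 ≤ N`): crossings from the
inner boundary to the outer boundary versus crossings between the two segments of the real line. [cite: Nolin2008, §4.4 and §4.6] [cite: KestenPTM1982, §2.2–2.3] -/
def uQuad (k N : ℕ) (hk : 1 ≤ k) (hkN : k + 1 ≤ N) : TriQuad where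
  U := uSites k N
  L := uL k N
  R := uR k N
  B := uB k N
  T := uT k N
  hB := uB_subset hk
  hT := uT_subset hk
  hex := uQuad_hex hk hkN
  meet := uQuad_meet hk hkN
  refTB := uQuad_refTB hk hkN

/-- **Colour switching in the half-plane, two arms**: at `p = 1/2`, two disjoint open crossings
of the U-shaped half-annulus `U_{k,N}` from its inner boundary to its outer boundary are no more
likely than an open one together with a closed one (monochromatic two-arm half-plane events are
dominated by bichromatic ones; Aizenman–Duplantier–Aharony colour switching, Nolin 2008, §4.6 with
Thm. 24 (i) "for any `σ ∈ 𝔖₂`"; Werner, "Color switching", 4)). [cite: Nolin2008, §4.6 with Thm. 24 (i) (arXiv 0711.4948: Thm. 23 (i))] [cite: WernerPCMI2009, Lecture 2, first exercise sheet ("Color switching", 2), 4))] -/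
theorem real_uTwoOpen_le (hk : 1 ≤ k) (hkN : k + 1 ≤ N) :
    (triSitePercolation half).real (uQuad k N hk hkN).twoOpen ≤
      (triSitePercolation half).real
        ({ω | ∃ x ∈ uL k N, ∃ y ∈ uR k N, PathIn triGraph (↑(uSites k N) ∩ ω) x y} ∩
          {ω | ∃ x ∈ uL k N, ∃ y ∈ uR k N, PathIn triGraph (↑(uSites k N) ∩ ωᶜ) x y}) :=
  (uQuad k N hk hkN).real_twoOpen_le

/-- **Two disjoint open inner–outer crossings are as likely as an open one with a closed one
"above" it** (exact colour switching in `U_{k,N}`, `P_{1/2}(C_{2,(1,1)}) = P_{1/2}(C_{2,(1,0)})`,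
the crossings being ordered by the explored set of the innermost one). [cite: WernerPCMI2009, Lecture 2, first exercise sheet ("Color switching", 2), 4))] -/
theorem real_uTwoOpen_eq (hk : 1 ≤ k) (hkN : k + 1 ≤ N) :
    (triSitePercolation half).real (uQuad k N hk hkN).twoOpen =
      (triSitePercolation half).real (uQuad k N hk hkN).openThenClosed :=
  (uQuad k N hk hkN).real_twoOpen_eq_real_openThenClosed

end Literature.Probability.Percolation
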